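import Mathlib
import Summits.Ventures.PercRepro2.LeafRowPendantRootSO
import Summits.Ventures.PercRepro2.CRPrincipal

/-!
# The open sign `crossA′so` is free along the root edge `a₁–a₂`
(blind cell PercRepro2, p5 g32; `proofs/P5-OEDGE.md` §42 (7), S4 §2.4 (s) addendum 19)

Let `e` be an edge with ends `a₁, a₂` and weight `q = p e`.  Every `Q`-mass of
`crossA′so = 2Z·P(Q,vL,oH,bH) − P(Q,bH)·P(Q,vL,oH) + π_v·P(Q,oH)·P(Q,bH) − P(Q,oH)·P(Q,vL,bH)`
carries the factor `1 − q` (the event `Q = {a₂ ↮ a₁}` forces `e` closed: `prob_Q_inter_update_one`,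
`prob_Q_inter_pin`), while `π_v = P(a₁ ↔ v)` only grows when `e` is pinned open
(`prob_update_zero_le_prob_update_one`).  Hence

  `crossA′so(p) = (1 − q)²·[2Z₀·Dv₀ + π_v(p)·x₀y₀ − y₀p₁₀ − x₀p₂₀] ≥ (1 − q)²·crossA′so(p₀)`

(**`crossA'so_root_edge`**), and the sign at the graph with `e` deleted gives the sign at `G`
(**`crossA'so_nonneg_of_root_edge`**): the root edge is FREE for the open sign — the first step of
the a₁-edge induction skeleton (every a₁-edge would do, were its two middle Bernstein coefficients
theorems).  Own work; standard axioms.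
-/

namespace Summit.Ventures.PercRepro2

open LeafRowPendantRootSO

namespace CrossAPrimeRootEdge

section Pin

variable {V : Type*} {E : Type*} [Fintype E] [DecidableEq E] {R : Type*} [CommRing R]

omit [Fintype E] [DecidableEq E] in
/-- An open edge with ends `a₂, a₁` puts `a₁` in the cluster of `a₂`: `Q` forces it closed. -/
lemma Q_inter_openEdge_eq_empty {ends : E → Sym2 V} {e : E} {a₁ a₂ : V}
    (he : ends e = s(a₁, a₂)) :
    avoidAll ends a₂ {a₁} ∩ openEdge e = ∅ := by
  ext ω
  simp only [Set.mem_inter_iff, Set.mem_empty_iff_false, iff_false, not_and]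
  intro hQ ho
  rw [mem_avoidAll] at hQ
  apply hQ a₁ (Finset.mem_singleton_self a₁)
  exact conn_of_openAdj ⟨e, ho, by rw [he, Sym2.eq_swap]⟩

/-- With the root edge pinned open, every `Q`-mass vanishes. -/
lemma prob_Q_inter_update_one (p : E → R) {ends : E → Sym2 V} {e : E} {a₁ a₂ : V}
    (he : ends e = s(a₁, a₂)) (X : Set (Config E)) :
    prob (Function.update p e 1) (avoidAll ends a₂ {a₁} ∩ X) = 0 := by
  rw [← prob_update_one_inter_openEdge, Set.inter_right_comm, Q_inter_openEdge_eq_empty he,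
    Set.empty_inter, prob_empty]

/-- Every `Q`-mass carries the factor `1 − p e` of the root edge. -/
lemma prob_Q_inter_pin (p : E → R) {ends : E → Sym2 V} {e : E} {a₁ a₂ : V}
    (he : ends e = s(a₁, a₂)) (X : Set (Config E)) :
    prob p (avoidAll ends a₂ {a₁} ∩ X) =
      (1 - p e) * prob (Function.update p e 0) (avoidAll ends a₂ {a₁} ∩ X) := by
  rw [prob_eq_pin p _ e, prob_Q_inter_update_one p he, mul_zero, zero_add]

end Pin

section Main

variable {V : Type*} {E : Type*} [Fintype E] [DecidableEq E] {R : Type*} [Field R]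
  [LinearOrder R] [IsStrictOrderedRing R]

/-- **The root edge is free**: `(1 − p e)² · crossA′so(p with e deleted) ≤ crossA′so(p)`. -/
theorem crossA'so_root_edge {p : E → R} (hp : IsProbVec p) {ends : E → Sym2 V} {e : E}
    {o a₁ a₂ v b : V} (he : ends e = s(a₁, a₂)) :
    (1 - p e) ^ 2 * crossA'so (Function.update p e 0) ends o a₁ a₂ v b ≤
      crossA'so p ends o a₁ a₂ v b := by
  have hQ : ∀ X, prob p (avoidAll ends a₂ {a₁} ∩ X) =
      (1 - p e) * prob (Function.update p e 0) (avoidAll ends a₂ {a₁} ∩ X) :=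
    fun X => prob_Q_inter_pin p he X
  have hZ : prob p (avoidAll ends a₂ {a₁}) =
      (1 - p e) * prob (Function.update p e 0) (avoidAll ends a₂ {a₁}) := by
    have := hQ Set.univ; simpa only [Set.inter_univ] using this
  have hπ : prob (Function.update p e 0) (connEvent ends a₁ v) ≤ prob p (connEvent ends a₁ v) := by
    rw [prob_eq_pin p (connEvent ends a₁ v) e]
    have h01 := CRPrincipal.prob_update_zero_le_prob_update_one hp (isUpperSet_connEvent ends a₁ v) e
    have h0 := hp.nonneg e
    have h1 := hp.le_one e
    nlinarith [mul_le_mul_of_nonneg_left h01 h0]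
  unfold crossA'so
  simp only [hZ, hQ]
  set q := p e with hq
  set p₀ := Function.update p e 0
  have hp₀ : IsProbVec p₀ := hp.update e le_rfl zero_le_one
  have hx := prob_nonneg hp₀ (avoidAll ends a₂ {a₁} ∩ connEvent ends a₂ o)
  have hy := prob_nonneg hp₀ (avoidAll ends a₂ {a₁} ∩ connEvent ends a₂ b)
  have hq1 : 0 ≤ (1 - q) ^ 2 := sq_nonneg _
  have key : 0 ≤ (1 - q) ^ 2 *
      ((prob p (connEvent ends a₁ v) - prob p₀ (connEvent ends a₁ v)) *
        (prob p₀ (avoidAll ends a₂ {a₁} ∩ connEvent ends a₂ o) *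
          prob p₀ (avoidAll ends a₂ {a₁} ∩ connEvent ends a₂ b))) :=
    mul_nonneg hq1 (mul_nonneg (sub_nonneg.2 hπ) (mul_nonneg hx hy))
  nlinarith [key]

/-- **The sign at `G − a₁a₂` gives the sign at `G`.** -/
theorem crossA'so_nonneg_of_root_edge {p : E → R} (hp : IsProbVec p) {ends : E → Sym2 V} {e : E}
    {o a₁ a₂ v b : V} (he : ends e = s(a₁, a₂))
    (h0 : 0 ≤ crossA'so (Function.update p e 0) ends o a₁ a₂ v b) :
    0 ≤ crossA'so p ends o a₁ a₂ v b :=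
  le_trans (mul_nonneg (sq_nonneg _) h0) (crossA'so_root_edge hp he)

end Main

end CrossAPrimeRootEdge

end Summit.Ventures.PercRepro2
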